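import Summits.Ventures.CertifiedManyBodySolver.Downfold.EmeryShapeWindowClosure
import Summits.Ventures.CertifiedManyBodySolver.Downfold.EmeryFermiScalePointsTl2223IPK11VirtualCorners
import HarnessLib

/-!
# THE ONE-BAND FERMI-SURFACE SHAPE `t′/t` OF THE WHOLE TYPED 3BE BOX `emeryBoxTl2223IPK11Src (EmeryBoxesKSlicesS)` FROM TWO VIRTUAL CORNERS (two-ray rule + window closure, §B.86;
# router/EMERY-SHAPE-CORNERS.tsv)

Venture CertifiedManyBodySolver, cell `pub/hubbard-downfold` (stage S1; INFLATION-RULES-3to1-B §B.86 (i)), seat hubbard-downfold-mod-4 (technique B, g35); namespace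
`Summit.Ventures.CertifiedManyBodySolver.Downfold.Emery`. Everything PROVED (0 sorry). WHAT THIS IS NOT: a statement about Tl₂Ba₂Ca₂Cu₃O₁₀ INNER plane ((K) source box) — the typed box is SCREENING-GRADE (its file's
grade line); `U = 0` one-body kinematics of the σ model (object E = the EXACT `t–t′` shape of the σ Fermi surface, `EmeryFermiSurfaceShape`); no interaction, no `t″`.

For EVERY one-body row `(Δ, t_pd, t_pp, t_pp′) ∈ [37/25, 56/25] × [59/50, 139/100] × [31/50, 73/100] × [3/20, 19/100]` eV and the fillings below, the one-band `t′/t` of the σ-model Fermi surface AT THAT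
ROW'S OWN FERMI ENERGY lies in the window of the table (device: `EmeryShapeTwoRayRule` + `EmeryShapeWindowClosure`, exactly as `EmeryBoxesLa214ShapeCorners`; virtual corners
`V_lo = (1.48, 1.18, 0.73, 0.2237)`, `V_hi = (2.24, 1.39, 0.62, 0.1274)`, t_pp′ outside the typed range by the factor b₂/b₁ = 1.177 — the explicit 3 → 1 inflation, zero iff the box is pure or of fixed
t_pp′/t_pp ratio; certificates `EmeryFermiScalePointsTl2223IPK11VirtualCorners`).

| filling | certified window for t′/t over the WHOLE box | V_lo ε_F bracket | V_hi ε_F bracket | lower closure | EMERY-FS-WINDOWS (g19 sub-box device) | object-E row of record [float] |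
|---|---|---|---|---|---|---|
| n_H = 1.14 (ν = 43/100) | **[-0.3419, -0.2539]** | [1.6224, 1.6374] eV | [1.7904, 1.8004] eV | antitone (dd ≥ 0.389 on the window): L = fsRatio(V_lo; e₂) | [-0.3358,-0.2573] (n_H band) | [-0.447,-0.346] |
| n_H = 1.18 (ν = 41/100) | **[-0.3417, -0.2542]** | [1.5769, 1.5919] eV | [1.7535, 1.7635] eV | antitone (dd ≥ 0.319 on the window): L = fsRatio(V_lo; e₂) | [-0.3358,-0.2573] (n_H band) | [-0.447,-0.346] |

Sources: three-band model [HybertsenSchluterChristensen1989, Eq. (1)]; [AndersenEtAl1995, §6]; box rows as cited in the typed object's file.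
-/

noncomputable section

namespace Summit.Ventures.CertifiedManyBodySolver.Downfold.Emery

open Real Set

/-- **n_H = 1.14 (ν = 43/100): for every row of the box the one-band Fermi-surface `t′/t` (object E, at the row's own Fermi energy) lies in `[-0.3419, -0.2539]`.** Lower closure: antitone; upper: monotone. [folklore] -/
theorem tl2223IPK11Box_fsRatio_nH114 {Δ a b c : ℝ} (hΔ : Δ ∈ Icc ((37 : ℝ) / 25) ((56 : ℝ) / 25)) (ha : a ∈ Icc ((59 : ℝ) / 50) ((139 : ℝ) / 100)) (hb : b ∈ Icc ((31 : ℝ) / 50) ((73 : ℝ) / 100)) (hc : c ∈ Icc ((3 : ℝ) / 20) ((19 : ℝ) / 100)) :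
    fsRatio Δ a b c (fermiEnergyOf Δ a b c ((43 : ℝ) / 100)) ∈ Icc ((-3419 : ℝ) / 10000) ((-2539 : ℝ) / 10000) := by
  have hV : ((19 : ℝ) / 100) * ((73 : ℝ) / 100) / ((31 : ℝ) / 50) = ((1387 : ℝ) / 6200) := by norm_num
  have hW : ((3 : ℝ) / 20) * ((31 : ℝ) / 50) / ((73 : ℝ) / 100) = ((93 : ℝ) / 730) := by norm_num
  have hVlo := (fermiEnergyOf_of_pointBracketCheck virtPt_Tl2223IPK11Vlo_nH114_br (by norm_num) (by norm_num) (by norm_num) (ν := (43/100 : ℝ)) (by push_cast; exact ⟨le_rfl, le_rfl⟩)).2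
  have hVhi := (fermiEnergyOf_of_pointBracketCheck virtPt_Tl2223IPK11Vhi_nH114_br (by norm_num) (by norm_num) (by norm_num) (ν := (43/100 : ℝ)) (by push_cast; exact ⟨le_rfl, le_rfl⟩)).2
  have hAlo := (fermiEnergyOf_of_pointBracketCheck virtPt_Tl2223IPK11Alo_nH114_br (by norm_num) (by norm_num) (by norm_num) (ν := (43/100 : ℝ)) (by push_cast; exact ⟨le_rfl, le_rfl⟩)).2
  have hTop := (fermiEnergyOf_of_pointBracketCheck virtPt_Tl2223IPK11H_nH114_br (by norm_num) (by norm_num) (by norm_num) (ν := (43/100 : ℝ)) (by push_cast; exact ⟨le_rfl, le_rfl⟩)).2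
  push_cast at hVlo hVhi hAlo hTop
  norm_num at hVlo hVhi hAlo hTop
  refine fsRatio_fermiEnergyOf_mem_Icc_windowClosure (Δ₁ := ((37 : ℝ) / 25)) (Δ₂ := ((56 : ℝ) / 25)) (a₁ := ((59 : ℝ) / 50)) (a₂ := ((139 : ℝ) / 100)) (b₁ := ((31 : ℝ) / 50))
    (b₂ := ((73 : ℝ) / 100)) (c₁ := ((3 : ℝ) / 20)) (c₂ := ((19 : ℝ) / 100)) (e₁ := ((1014 : ℝ) / 625)) (e₂ := ((17027 : ℝ) / 10000)) (e₃ := 0) (e₄ := ((4501 : ℝ) / 2500)) (by norm_num) (by norm_num) (by norm_num) (by norm_num)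
    (by norm_num) hΔ ha hb hc (by norm_num) (by norm_num) ?_ ?_ ?_ (by norm_num) ?_ ?_ ?_ (by norm_num) ?_
  · -- regime at the box's Fermi-energy high corner: c₂ b₂ ε_F(Δ₁, a₂, b₂, c₁) ≤ a₁² b₁
    nlinarith [hTop.2]
  · rw [hV]; exact hVlo.1
  · exact hAlo.2
  · intro ε hε
    rw [hV]
    have hanti := (fsRatio_mem_Icc_on_window_of_dopingDisc_nonneg (Δ := ((37 : ℝ) / 25)) (a := ((59 : ℝ) / 50)) (b := ((73 : ℝ) / 100)) (c := ((1387 : ℝ) / 6200))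
      (p := ((1014 : ℝ) / 625)) (q := ((17027 : ℝ) / 10000)) (by norm_num) (by norm_num) (by norm_num) (by norm_num) (by norm_num) (by norm_num) (by norm_num)
      (by norm_num [dopingDisc]) hε).1
    refine le_trans ?_ hanti
    norm_num [fsRatio, fsD, fsN]
  · exact (fermiEnergyOf_pos (by norm_num) (by norm_num) (by norm_num) (by norm_num) (by norm_num) (by norm_num)).le
  · rw [hW]; exact hVhi.2
  · intro ε hε
    rw [hW]
    have hmono := (fsRatio_mem_Icc_on_window_of_dopingDisc_nonpos (Δ := ((56 : ℝ) / 25)) (a := ((139 : ℝ) / 100)) (b := ((31 : ℝ) / 50)) (c := ((93 : ℝ) / 730))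
      (p := 0) (q := ((4501 : ℝ) / 2500)) (by norm_num) (by norm_num) (by norm_num) (by norm_num) (by norm_num) (by norm_num) (by norm_num)
      (by norm_num [dopingDisc]) hε).2
    refine le_trans hmono ?_
    norm_num [fsRatio, fsD, fsN]

/-- **n_H = 1.18 (ν = 41/100): for every row of the box the one-band Fermi-surface `t′/t` (object E, at the row's own Fermi energy) lies in `[-0.3417, -0.2542]`.** Lower closure: antitone; upper: monotone. [folklore] -/
theorem tl2223IPK11Box_fsRatio_nH118 {Δ a b c : ℝ} (hΔ : Δ ∈ Icc ((37 : ℝ) / 25) ((56 : ℝ) / 25)) (ha : a ∈ Icc ((59 : ℝ) / 50) ((139 : ℝ) / 100)) (hb : b ∈ Icc ((31 : ℝ) / 50) ((73 : ℝ) / 100)) (hc : c ∈ Icc ((3 : ℝ) / 20) ((19 : ℝ) / 100)) :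
    fsRatio Δ a b c (fermiEnergyOf Δ a b c ((41 : ℝ) / 100)) ∈ Icc ((-3417 : ℝ) / 10000) ((-1271 : ℝ) / 5000) := by
  have hV : ((19 : ℝ) / 100) * ((73 : ℝ) / 100) / ((31 : ℝ) / 50) = ((1387 : ℝ) / 6200) := by norm_num
  have hW : ((3 : ℝ) / 20) * ((31 : ℝ) / 50) / ((73 : ℝ) / 100) = ((93 : ℝ) / 730) := by norm_num
  have hVlo := (fermiEnergyOf_of_pointBracketCheck virtPt_Tl2223IPK11Vlo_nH118_br (by norm_num) (by norm_num) (by norm_num) (ν := (41/100 : ℝ)) (by push_cast; exact ⟨le_rfl, le_rfl⟩)).2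
  have hVhi := (fermiEnergyOf_of_pointBracketCheck virtPt_Tl2223IPK11Vhi_nH118_br (by norm_num) (by norm_num) (by norm_num) (ν := (41/100 : ℝ)) (by push_cast; exact ⟨le_rfl, le_rfl⟩)).2
  have hAlo := (fermiEnergyOf_of_pointBracketCheck virtPt_Tl2223IPK11Alo_nH118_br (by norm_num) (by norm_num) (by norm_num) (ν := (41/100 : ℝ)) (by push_cast; exact ⟨le_rfl, le_rfl⟩)).2
  have hTop := (fermiEnergyOf_of_pointBracketCheck virtPt_Tl2223IPK11H_nH118_br (by norm_num) (by norm_num) (by norm_num) (ν := (41/100 : ℝ)) (by push_cast; exact ⟨le_rfl, le_rfl⟩)).2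
  push_cast at hVlo hVhi hAlo hTop
  norm_num at hVlo hVhi hAlo hTop
  refine fsRatio_fermiEnergyOf_mem_Icc_windowClosure (Δ₁ := ((37 : ℝ) / 25)) (Δ₂ := ((56 : ℝ) / 25)) (a₁ := ((59 : ℝ) / 50)) (a₂ := ((139 : ℝ) / 100)) (b₁ := ((31 : ℝ) / 50))
    (b₂ := ((73 : ℝ) / 100)) (c₁ := ((3 : ℝ) / 20)) (c₂ := ((19 : ℝ) / 100)) (e₁ := ((15769 : ℝ) / 10000)) (e₂ := ((1036 : ℝ) / 625)) (e₃ := 0) (e₄ := ((3527 : ℝ) / 2000)) (by norm_num) (by norm_num) (by norm_num) (by norm_num)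
    (by norm_num) hΔ ha hb hc (by norm_num) (by norm_num) ?_ ?_ ?_ (by norm_num) ?_ ?_ ?_ (by norm_num) ?_
  · -- regime at the box's Fermi-energy high corner: c₂ b₂ ε_F(Δ₁, a₂, b₂, c₁) ≤ a₁² b₁
    nlinarith [hTop.2]
  · rw [hV]; exact hVlo.1
  · exact hAlo.2
  · intro ε hε
    rw [hV]
    have hanti := (fsRatio_mem_Icc_on_window_of_dopingDisc_nonneg (Δ := ((37 : ℝ) / 25)) (a := ((59 : ℝ) / 50)) (b := ((73 : ℝ) / 100)) (c := ((1387 : ℝ) / 6200))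
      (p := ((15769 : ℝ) / 10000)) (q := ((1036 : ℝ) / 625)) (by norm_num) (by norm_num) (by norm_num) (by norm_num) (by norm_num) (by norm_num) (by norm_num)
      (by norm_num [dopingDisc]) hε).1
    refine le_trans ?_ hanti
    norm_num [fsRatio, fsD, fsN]
  · exact (fermiEnergyOf_pos (by norm_num) (by norm_num) (by norm_num) (by norm_num) (by norm_num) (by norm_num)).le
  · rw [hW]; exact hVhi.2
  · intro ε hε
    rw [hW]
    have hmono := (fsRatio_mem_Icc_on_window_of_dopingDisc_nonpos (Δ := ((56 : ℝ) / 25)) (a := ((139 : ℝ) / 100)) (b := ((31 : ℝ) / 50)) (c := ((93 : ℝ) / 730))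
      (p := 0) (q := ((3527 : ℝ) / 2000)) (by norm_num) (by norm_num) (by norm_num) (by norm_num) (by norm_num) (by norm_num) (by norm_num)
      (by norm_num [dopingDisc]) hε).2
    refine le_trans hmono ?_
    norm_num [fsRatio, fsD, fsN]

end Summit.Ventures.CertifiedManyBodySolver.Downfold.Emery
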